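import Summits.MatrixMultiplication.MatrixMultiplication.Theorems.TetraDiagonalLadder
import Summits.MatrixMultiplication.MatrixMultiplication.Theorems.TetraDiagonalSymm
import HarnessLib

/-!
# TetraDiagonalLimit — `ω(K₄) ≤ 3·ω_diag(ε)/(2+ε)`: the diagonal ladder converges to the leaf,
`TetraFlat ⟺ ∀ ε < 1, ω_diag(ε) ≤ 4`

(decomp-mm lens 6 «barrier-complement carving», generation 19; kernel C of NODE-g19, companion of
`TetraDiagonal{Core,Ladder,Cover}`; supports the attacked leaf `TetraFlat` (item 33477) of the cut of
record `ω = 2 ⟺ TetraFlat ∧ TetraNoSaving` (route `TetrahedronCarving`). No item is added or changed.)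

QUESTION. The thin-diagonal tetrahedra `Z_n^{(d)} = T_f(K₄)`, `f = (d on the matching {01,23}, n on
the 4-cycle)`, give the rung ladder `ω_diag(ε) ≤ 4` (`0 ≤ ε ≤ 1`) under `TetraFlat = [ω_diag(1) ≤ 4]`
(kernel A2). Do the rungs say anything about the leaf's OWN quantity `ω(K₄)` — or only about the
rectangular shadows `ω(2,ε,2)`, `α`? CVZ19's symmetrisation for edge-transitive graphs
(§2.1, the step `(nonuniformsymm)` in the proof of Thm. 2.1.6) answers: multiply the three rotations.

RESULTS (sorry-free, over any field; `ℂ` for the route statements):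
* `tensorRankD_tetra_le_diagTetra_cube` — `R₄(T(K₄)_{d·n²}) ≤ R₄(Z_n^{(d)})³` (`d ≤ n`): the
  Kronecker product of `Z` with its two rotations (thin matching `{02,13}`, resp. `{03,12}`; same rank
  by the vertex symmetries `(12)`, `(13)` of `K₄`, `exists_rankOne_decomposition_rot₂/rot₃`) is
  `T(K₄)` with `d·n·n` labels on every edge, embedded by an explicit per-edge relabelling
  (`tetra_relabel`).
* `omegaTetra_le_symm` — `ω(K₄) ≤ 3·ω_diag(ε)/(2+ε)` for `0 ≤ ε ≤ 1` (equality at `ε = 1`); hence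
  `le_omegaDiag_symm : (2+ε)/3 · ω(K₄) ≤ ω_diag(ε)`, the CONTINUITY AT THE TOP
  `omegaTetra_sub_omegaDiag_le : ω(K₄) - ω_diag(ε) ≤ (1-ε)/3 · ω(K₄) ≤ 2(1-ε)`, and per rung
  `omegaTetra_le_of_omegaDiag_le_four : ω_diag(ε) ≤ 4 ⟹ ω(K₄) ≤ 12/(2+ε)` (a rung at `ε` is partial
  progress ON THE LEAF: `6 → 4` as `ε : 0 → 1`; beyond the printed `ω(K₄) < 4.633908` iff `ε > 0.5896`).
* `tetraFlat_iff_forall_omegaDiag_le_four` — **the ladder converges to the leaf**: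
  `TetraFlat ⟺ ∀ ε ∈ [0,1), ω_diag(ε) ≤ 4`. Together with kernel B (every rung's no-saving residual is
  summit-equivalent) this places the whole diagonal deformation: below the top the residuals are
  costumes and the flatness rungs are strictly partial; only their LIMIT is the attacked leaf.
Sources: [corpus:paper-arxiv-1609.07476 p.11–12 (§2.1, `T_f(G)`, (nonuniformsymm), Thm. 2.1.6)] ·
[cite: ChristandlVranaZuiddam2016, Prop. 1.1.16] (level certificates, tree `omegaTetra_le_of_level`).
No `sorry`, no new axiom, no instance, no notation, no definition.
-/

noncomputable section

set_option linter.dupNamespace false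

open Filter Asymptotics Literature.Computability.AlgebraicComplexity
open Summit.MatrixMultiplication.MatrixMultiplication.Theorems.TetrahedronTensor
open Summit.MatrixMultiplication.MatrixMultiplication.Theses.TetrahedronCarving

namespace Summit.MatrixMultiplication.MatrixMultiplication.Theorems.TetraDiagonal

/-! ## §13 `ω(K₄) ≤ 3·ω_diag(ε)/(2+ε)` and the convergence of the ladder -/

section Exponent

variable (F : Type) [Field F]

/-- **Symmetrisation, admissible-exponent form**: if `β` is admissible for the `ε`-thin family
(`0 ≤ ε ≤ 1`) then `ω(K₄) ≤ 3β/(2+ε)`: at the levels `m_n = ⌈n^ε⌉·n² ≥ n^{2+ε}`,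
`R₄(T(K₄)_{m_n}) ≤ (C n^β)³ = m_n^{θ_n}` with `θ_n → 3β/(2+ε)`, and one level certifies
(`omegaTetra_le_of_level`). [cite: ChristandlVranaZuiddam2016, §2.1 (nonuniformsymm)] -/
theorem omegaTetra_le_of_mem_diagAdmissibleExponents {ε β : ℝ} (hε0 : 0 ≤ ε) (hε1 : ε ≤ 1)
    (hβ : β ∈ diagAdmissibleExponents F ε) : omegaTetra F ≤ 3 * β / (2 + ε) := by
  have hβ0 : 0 ≤ β :=
    rectAdmissibleExponents_nonneg F (diagAdmissibleExponents_subset_rect F hε1 hβ)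
  obtain ⟨C, hC0, hC⟩ := bound_of_isBigO_nat_atTop hβ
  -- enlarge the constant to `C' ≥ 1`
  set C' : ℝ := max C 1 with hC'
  have hC'1 : 1 ≤ C' := le_max_right _ _
  have hC'pos : 0 < C' := by linarith
  have hlogC' : 0 ≤ Real.log C' := Real.log_nonneg hC'1
  have h2ε : 0 < 2 + ε := by linarith
  refine le_of_forall_pos_le_add fun δ hδ => ?_
  -- choose the level parameter `n`
  obtain ⟨n, hn2, hnlog⟩ : ∃ n : ℕ, 2 ≤ n ∧ 3 * Real.log C' / ((2 + ε) * δ) ≤ Real.log n := by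
    refine ⟨max 2 ⌈Real.exp (3 * Real.log C' / ((2 + ε) * δ))⌉₊, le_max_left _ _, ?_⟩
    have hE := Real.exp_pos (3 * Real.log C' / ((2 + ε) * δ))
    have h1 : Real.exp (3 * Real.log C' / ((2 + ε) * δ)) ≤
        ((max 2 ⌈Real.exp (3 * Real.log C' / ((2 + ε) * δ))⌉₊ : ℕ) : ℝ) := by
      calc Real.exp (3 * Real.log C' / ((2 + ε) * δ))
          ≤ (⌈Real.exp (3 * Real.log C' / ((2 + ε) * δ))⌉₊ : ℝ) := Nat.le_ceil _
        _ ≤ ((max 2 ⌈Real.exp (3 * Real.log C' / ((2 + ε) * δ))⌉₊ : ℕ) : ℝ) := by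
            exact_mod_cast le_max_right _ _
    have h2 := Real.log_le_log hE h1
    rwa [Real.log_exp] at h2
  have hn1 : 1 ≤ n := by omega
  have hnR : (2 : ℝ) ≤ n := by exact_mod_cast hn2
  have hnpos : (0 : ℝ) < n := by linarith
  have hlogn : 0 < Real.log n := Real.log_pos (by linarith)
  -- the thin parameter and the level
  set dn : ℕ := rectDim n ε with hdn
  have hdn1 : 1 ≤ dn := one_le_rectDim hn1 ε
  have hdnn : dn ≤ n := (rectDim_mono hn1 hε1).trans (rectDim_one n).le
  have hdnge : (n : ℝ) ^ ε ≤ (dn : ℝ) := Nat.le_ceil _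
  set m : ℕ := dn * (n * n) with hm
  have hm2 : 2 ≤ m := by
    have : 1 * (2 * 1) ≤ dn * (n * n) :=
      Nat.mul_le_mul hdn1 (Nat.mul_le_mul hn2 hn1)
    omega
  have hmR : (2 : ℝ) ≤ m := by exact_mod_cast hm2
  have hmpos : (0 : ℝ) < m := by linarith
  have hlogm : 0 < Real.log m := Real.log_pos (by linarith)
  -- the rank bound at level `m`
  have hZ : (tensorRankD (diagTetra F n dn) : ℝ) ≤ C' * (n : ℝ) ^ β := by
    have hne : ((n : ℕ) : ℝ) ^ β ≠ 0 := (Real.rpow_pos_of_pos hnpos β).ne'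
    have h := hC hne
    rw [Real.norm_of_nonneg (Nat.cast_nonneg _),
      Real.norm_of_nonneg (Real.rpow_nonneg (Nat.cast_nonneg _) _)] at h
    exact h.trans (mul_le_mul_of_nonneg_right (le_max_left _ _) (Real.rpow_nonneg hnpos.le _))
  have hZ0 : (0 : ℝ) ≤ (tensorRankD (diagTetra F n dn) : ℝ) := Nat.cast_nonneg _
  set B : ℝ := C' ^ 3 * (n : ℝ) ^ (3 * β) with hB
  have hB1 : 1 ≤ B := by
    have h1 : (1 : ℝ) ≤ C' ^ 3 := one_le_pow₀ hC'1
    have h2 : (1 : ℝ) ≤ (n : ℝ) ^ (3 * β) := Real.one_le_rpow (by linarith) (by positivity)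
    nlinarith
  have hBpos : 0 < B := by linarith
  have hcube : (tensorRankD (tetra F m) : ℝ) ≤ B := by
    have h := tensorRankD_tetra_le_diagTetra_cube (F := F) (n := n) (d := dn) hdnn
    calc (tensorRankD (tetra F m) : ℝ) ≤ ((tensorRankD (diagTetra F n dn) ^ 3 : ℕ) : ℝ) := by
          exact_mod_cast h
      _ = (tensorRankD (diagTetra F n dn) : ℝ) ^ 3 := by push_cast; ring
      _ ≤ (C' * (n : ℝ) ^ β) ^ 3 := pow_le_pow_left₀ hZ0 hZ 3
      _ = B := by
          rw [hB, mul_pow, ← Real.rpow_natCast ((n : ℝ) ^ β) 3, ← Real.rpow_mul hnpos.le]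
          norm_num [mul_comm]
  -- the level certificate `R₄(T(K₄)_m) ≤ m^θ`, `θ = log B / log m`
  set θ : ℝ := Real.log B / Real.log m with hθ
  have hθ0 : 0 ≤ θ := div_nonneg (Real.log_nonneg hB1) hlogm.le
  have hcert : (tensorRankD (tetra F m) : ℝ) ≤ (m : ℝ) ^ θ := by
    have hlθ : Real.log (m : ℝ) * θ = Real.log B := by
      rw [hθ]; field_simp
    have : (m : ℝ) ^ θ = B := by
      rw [Real.rpow_def_of_pos hmpos, hlθ, Real.exp_log hBpos]
    rw [this]
    exact hcube
  have hω : omegaTetra F ≤ θ := omegaTetra_le_of_level F hm2 hθ0 hcert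
  -- `θ ≤ 3β/(2+ε) + δ`
  have hlogm_ge : (2 + ε) * Real.log n ≤ Real.log m := by
    have h1 : (n : ℝ) ^ (2 + ε) ≤ (m : ℝ) := by
      have : (n : ℝ) ^ (2 + ε) = (n : ℝ) ^ ε * ((n : ℝ) * n) := by
        rw [Real.rpow_add hnpos, Real.rpow_two]; ring
      rw [this, hm]
      push_cast
      exact mul_le_mul_of_nonneg_right hdnge (by positivity)
    have h2 := Real.log_le_log (Real.rpow_pos_of_pos hnpos _) h1
    rwa [Real.log_rpow hnpos] at h2
  have hlogB : Real.log B = 3 * Real.log C' + 3 * β * Real.log n := by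
    rw [hB, Real.log_mul (pow_pos hC'pos 3).ne' (Real.rpow_pos_of_pos hnpos _).ne', Real.log_pow,
      Real.log_rpow hnpos]
    push_cast
    ring
  have hθle : θ ≤ (3 * Real.log C' + 3 * β * Real.log n) / ((2 + ε) * Real.log n) := by
    rw [hθ, hlogB]
    exact div_le_div_of_nonneg_left (by positivity) (by positivity) hlogm_ge
  have hsplit : (3 * Real.log C' + 3 * β * Real.log n) / ((2 + ε) * Real.log n) =
      3 * β / (2 + ε) + 3 * Real.log C' / ((2 + ε) * Real.log n) := by
    field_simp
    ring
  have htail : 3 * Real.log C' / ((2 + ε) * Real.log n) ≤ δ := by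
    rw [div_le_iff₀ (by positivity)]
    have h := hnlog
    rw [div_le_iff₀ (by positivity)] at h
    linarith
  linarith

/-- **`ω(K₄) ≤ 3·ω_diag(ε)/(2+ε)`** for `0 ≤ ε ≤ 1` (equality at `ε = 1`, `omegaDiag_one`).
[cite: ChristandlVranaZuiddam2016, §2.1 (nonuniformsymm)] -/
theorem omegaTetra_le_symm {ε : ℝ} (hε0 : 0 ≤ ε) (hε1 : ε ≤ 1) :
    omegaTetra F ≤ 3 * omegaDiag F ε / (2 + ε) := by
  have h2ε : 0 < 2 + ε := by linarith
  refine le_of_forall_pos_le_add fun δ hδ => ?_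
  obtain ⟨β, hβ, hβlt⟩ := Real.lt_sInf_add_pos (diagAdmissibleExponents_nonempty F ε)
    (show 0 < δ * (2 + ε) / 3 by positivity)
  have h := omegaTetra_le_of_mem_diagAdmissibleExponents F hε0 hε1 hβ
  have hβle : β ≤ omegaDiag F ε + δ * (2 + ε) / 3 := by
    show β ≤ sInf (diagAdmissibleExponents F ε) + δ * (2 + ε) / 3
    exact hβlt.le
  calc omegaTetra F ≤ 3 * β / (2 + ε) := h
    _ ≤ 3 * (omegaDiag F ε + δ * (2 + ε) / 3) / (2 + ε) := by gcongr
    _ = 3 * omegaDiag F ε / (2 + ε) + δ := by field_simp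

/-- **Lower bound on the rungs from the leaf**: `(2+ε)/3 · ω(K₄) ≤ ω_diag(ε)` (`0 ≤ ε ≤ 1`).
[cite: ChristandlVranaZuiddam2016, §2.1 (nonuniformsymm)] -/
theorem le_omegaDiag_symm {ε : ℝ} (hε0 : 0 ≤ ε) (hε1 : ε ≤ 1) :
    (2 + ε) / 3 * omegaTetra F ≤ omegaDiag F ε := by
  have h := omegaTetra_le_symm F hε0 hε1
  have h2ε : 0 < 2 + ε := by linarith
  rw [le_div_iff₀ h2ε] at h
  have : (2 + ε) / 3 * omegaTetra F = omegaTetra F * (2 + ε) / 3 := by ring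
  rw [this, div_le_iff₀ (by norm_num : (0 : ℝ) < 3)]
  linarith

/-- **Continuity of the ladder at the top**: `ω(K₄) - ω_diag(ε) ≤ (1-ε)/3 · ω(K₄) ≤ 2(1-ε)`
(`0 ≤ ε ≤ 1`; with `ω_diag(ε) ≤ ω(K₄)` from kernel A2 this pins `ω_diag(ε) → ω(K₄)` as `ε → 1`).
[cite: ChristandlVranaZuiddam2016, §2.1 (nonuniformsymm)] -/
theorem omegaTetra_sub_omegaDiag_le {ε : ℝ} (hε0 : 0 ≤ ε) (hε1 : ε ≤ 1) :
    omegaTetra F - omegaDiag F ε ≤ (1 - ε) / 3 * omegaTetra F ∧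
      omegaTetra F - omegaDiag F ε ≤ 2 * (1 - ε) := by
  have h := le_omegaDiag_symm F hε0 hε1
  have h6 := omegaTetra_le_six F
  have h4 := four_le_omegaTetra F
  constructor
  · linarith
  · nlinarith

/-- **A rung is partial progress on the leaf**: `ω_diag(ε) ≤ 4 ⟹ ω(K₄) ≤ 12/(2+ε)` (`0 ≤ ε ≤ 1`;
`6` at `ε = 0`, `4` at `ε = 1`; below the printed `ω(K₄) < 4.633908` iff `ε > 0.5896`).
[cite: ChristandlVranaZuiddam2016, §2.1 (nonuniformsymm)] -/
theorem omegaTetra_le_of_omegaDiag_le_four {ε : ℝ} (hε0 : 0 ≤ ε) (hε1 : ε ≤ 1)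
    (h : omegaDiag F ε ≤ 4) : omegaTetra F ≤ 12 / (2 + ε) := by
  have h2ε : 0 < 2 + ε := by linarith
  calc omegaTetra F ≤ 3 * omegaDiag F ε / (2 + ε) := omegaTetra_le_symm F hε0 hε1
    _ ≤ 3 * 4 / (2 + ε) := by gcongr
    _ = 12 / (2 + ε) := by norm_num

/-- **The ladder converges to the leaf**: `TetraFlat ⟺ ∀ ε ∈ [0,1), ω_diag(ε) ≤ 4`. (`⟹` is restriction,
kernel A2; `⟸`: `ω(K₄) ≤ 12/(2+ε)` for every `ε < 1`.)
[cite: ChristandlVranaZuiddam2016, §2.1 (nonuniformsymm)] -/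
theorem tetraFlat_iff_forall_omegaDiag_le_four :
    TetraFlat ↔ ∀ ε : ℝ, 0 ≤ ε → ε < 1 → omegaDiag ℂ ε ≤ 4 := by
  constructor
  · intro h ε _ hε1
    exact omegaDiag_le_four_of_tetraFlat h hε1.le
  · intro h
    show omegaTetra ℂ ≤ 4
    by_contra hlt'
    have hlt : 4 < omegaTetra ℂ := not_le.mp hlt'
    set t := omegaTetra ℂ with ht
    have h6 : t ≤ 6 := omegaTetra_le_six ℂ
    -- `ε = 1 - (t-4)/12 ∈ [0,1)` and `12/(2+ε) < t`
    have hε0 : 0 ≤ 1 - (t - 4) / 12 := by linarith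
    have hε1 : 1 - (t - 4) / 12 < 1 := by linarith
    have hb := omegaTetra_le_of_omegaDiag_le_four ℂ hε0 hε1.le (h _ hε0 hε1)
    have h2ε : 0 < 2 + (1 - (t - 4) / 12) := by linarith
    rw [← ht, le_div_iff₀ h2ε] at hb
    nlinarith

/-- **Rungs in leaf units**: under `TetraFlat` every rung holds, and conversely each rung `ε` alone
already gives `ω(K₄) ≤ 12/(2+ε)`; in particular a proof of the rungs for all `ε < 1` IS a proof of the
attacked leaf (item 33477), while (kernel B) each rung's no-saving residual is summit-equivalent. -/
theorem omegaTetra_le_of_rungs {ε₀ : ℝ} (hε0 : 0 ≤ ε₀) (hε1 : ε₀ ≤ 1)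
    (h : ∀ ε : ℝ, 0 ≤ ε → ε ≤ ε₀ → omegaDiag ℂ ε ≤ 4) : omegaTetra ℂ ≤ 12 / (2 + ε₀) :=
  omegaTetra_le_of_omegaDiag_le_four ℂ hε0 hε1 (h ε₀ hε0 le_rfl)

end Exponent

end Summit.MatrixMultiplication.MatrixMultiplication.Theorems.TetraDiagonal

end
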